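import Summits.HodgeConjecture.HodgeConjecture.Theorems.R90S10ArchSignKitDefs      -- ★ the DEFINITIONS of FILE E (law L9): carriers, (E-D1)–(E-D4), (E-K) `ArchSignKit`, read-offs, `archDeltaPP`
import Literature.NumberTheory.Rogawski1990.ArchCompatibleFamilies                   -- ★ `ArchCompatibleFamiliesH`, `OrbitalMeasureFamily.IsQuotientOf` (print's measure convention at ∞)
import Summits.HodgeConjecture.HodgeConjecture.Theorems.R90S10ArchTransferSignsOfArchKit   -- ★ p863153 (R90-C138-p08): `archTransferSigns_of_archBlockPacketIdentity (hS2 : ‹S2 letter›) : ‹(E-S1)›` — the (E-S1) PAYER modulo `hS2` (ED. 3)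
import Summits.HodgeConjecture.HodgeConjecture.Cruxes.H413.Lines.R90_S2_ArchBlockPacketLetterD   -- S2 FILE D (R90-C11-typ2 (g3)): ONE socket `R90.S2.stub_R90_S2_archBlockPacketSigns` = TYPE of `hS2` (ED. 3; Lines→Lines)
import Summits.HodgeConjecture.HodgeConjecture.Theorems.R90S10ArchSignKitCuspOfArchBlockPacketCusp   -- ★ (H-E4-1) (R90-C138-p05 (g0), DEAL #34): `archSignKitCusp_of_archBlockPacketCusp (hT2 : ‹TYPE of S2's T2›) : ‹kit with (g)'s pins›` (ED. 4)
import HarnessLib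

/-!
# R90-TF · S10 (Rogawski 1990 §13.8) · FILE E — ARCHIMEDEAN PSEUDO-COEFFICIENT ∕ SIGN-KIT FLOOR `R90_S10_ArchPseudoCoeffExtE` (the two NAMED STUBS)

Cell hodgecm-mathlib, slab R90-TF (director brief v2), section S10 = §13.8 «Proofs of local results» (Props. 13.8.1–13.8.3), crux item h413 =
stmt-HodgeConjecture-24833 (route `route-HodgeConjecture-HCCMUnconditional`).  Pen: R90-C138-typ1 (g2) (DEAL #3 (2) of R90-C138-plan (g0), 2026-09-04T15:46:21Z;
HEADS-E.v1 fcaaafca48503716 «=» 15:55:44Z; AUDIT S10#E 15:58:39Z: PASS ON SHAPE, E-F1 BLOCKING fix (a)(b) FOLDED in (E-S1), E-F2 no ★ `IsCanonical` at `∞`, E-F4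
hypothesis-first transfer, E-F5 «integrable» said, E-F3 is typ4's membership clause).  LAW L9 «DEFINITIONS DOWN»: every definition the two stub TYPES mention —
the block carriers `phi3 ∕ GInf ∕ HInf`, (E-D1) `IsArchStablyNull`, (E-D2) `IsArchSignTest`, (E-D3) `IsArchEndoCharId`, (E-D4) `IsArchPseudoCoeffSystem`, (E-K)
`ArchSignKit` (+ `frozenG`, PROVED read-offs (E-R1) `isArchSignTest_frozenG`, (E-R2) `hasArchOpTrace_two`), `archDeltaPP` — lives in the sorry-free ★ `Theorems`
file `R90S10ArchSignKitDefs` (same namespace), so that the payer of (E-S1) can state its type without importing this file; THIS file = EXACTLY the two named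
stubs of the S10 DAG's archimedean floor (`C → E → C2 → B → A`; C = `R90_S10_ZeroSliceDefsC`, C2∕B = typ4, A = typ3, D = typ2):
* (E-X1) EXTERNAL «pseudo-coefficients of the discrete series exist» ↦ `stub_R90_ext_pseudoCoeffDS_u : ArchPacketSignsLetter` — the ★ E1b letter BY NAME (one E1b
  payment closes E1b U8 and E-X1; never dealt in S10);
* (E-S1) INTERNAL ↦ `sock_S10_archTransferSigns_u : … → Nonempty (ArchSignKit L (archDeltaPP L μ) mH mG ν νH)` AT PRINT'S NORMALISED DATA (AUDIT S10#E E-F1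
  folded): the factor is PINNED to print's `Δ″_∞ = archDeltaPP L μ` (★ `archExplicitTransferFactor` at `Φ₃`, the archimedean twin of ★ `Pinned1383Letter`'s
  `finExplicitCollection … μ`), the orbital-measure families are the WEIL-FORM quotients of the trace measures `ν`, `νH` with Langlands–Shelstad TRANSPORT
  ((W) ★ `IsQuotientOf`, (C) verbatim from ★ `ArchCompatibleFamiliesG`, (W_H)+(C_H) ★ `ArchCompatibleFamiliesH`) — never ★ `IsCanonical` at `∞` (unsatisfiable for
  non-compact real tori, E-F2); payer S2 (R90-C11 ∕ K2E1b) from Prop. 12.3.2 + [ClozelDelorme] for an INTEGRABLE packet (E-F5); the archimedean Δ-transfer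
  relation enters as the HYPOTHESIS ★ `IsArchDeltaTransferExists` = floor item (E5) [Shelstad], OWNER S6 `sock_S6_ext_archTransferShelstad` (LEAD #18 (1));
  ★ `ArchEndoscopicTransferExists` is anisotropy-guarded, hence not usable for the quasi-split `Φ₃`.
* JUNCTION J-E∕C2 (typ4's `S10HDatum`, rulings R90-C138-plan 15:55:44Z ∕ 16:09:43Z): ED. 1 of C2 carries the arch position as ONE existentially closed field
  `harch` whose clause BODIES are (E-D1)∕(E-D2) verbatim and «`HasArchOpTrace νH ρ … fH∞ 2`»; ED. 2 imports `R90S10ArchSignKitDefs` and adds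
  `𝔞 : ArchSignKit L (archDeltaPP L μ) mH mG ν νH` with the (E-S1) binders token for token; `S10Frozen 𝔥` carries `FH∞`, `hsmH : ArchSmooth₂ L ⇑FH∞`,
  `htr∞ : IsArchDeltaTransfer L Φ₃ (archDeltaPP L μ) mH mG ⇑FH∞ ⇑𝔥.𝔞.frozenG`, `hSOu : IsArchStablyNull L mG ⇑𝔥.𝔞.frozenG`; the values `haH = 2` ∕ `hsign` of the
  Flath layer are DERIVED from (E-R2) ∕ (E-R1), never posited (the `H_∞`-representation field is `𝔞.ρH`).

ED. 3 (typ2 (g3), 2026-09-05; dealer R90-C138-plan (g2) docket 2026-09-04T23:59:04Z; ADDITIONS-ONLY over ED. 2 = tree f0236f114018c0a9 except the BODY of (E-S1)):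
two imports added — ★ `Theorems/R90S10ArchTransferSignsOfArchKit` (R90-C138-p08, p863153: `archTransferSigns_of_archBlockPacketIdentity (hS2 : ‹S2's letter›) :
‹the statement of (E-S1), token for token›`) and S2's ONE-SOCKET Lines file `Cruxes/H413/Lines/R90_S2_ArchBlockPacketLetterD` (R90-C11-typ2 (g3); its socket
`R90.S2.stub_R90_S2_archBlockPacketSigns` has as statement the TYPE of the binder `hS2`, token for token; a Lines→Lines import is legal here since only
`R90_TF_Index` imports THIS file) — and (E-S1) `sock_S10_archTransferSigns_u` is now PAID MODULO S2's socket: its STATEMENT bytes are frozen (ED. 2 :81–:107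
verbatim), its body is `exact archTransferSigns_of_archBlockPacketIdentity R90.S2.stub_R90_S2_archBlockPacketSigns`.  This SUPERSEDES two sentences of the
paragraph below («Sorries = exactly the two named stubs», «no `Cruxes/…/Lines` import»): sorries in THIS file = exactly ONE, (E-X1) `stub_R90_ext_pseudoCoeffDS_u`
(EXTERNAL, never dealt in S10); `--axioms sock_S10_archTransferSigns_u` = TRIO ∪ {`sorryAx` via S2's socket} until S2 pays it (payer road: Clozel–Delorme
pseudo-coefficients on the block + Shelstad's archimedean character identities, Prop. 12.3.2; XL); ONE `Cruxes/…/Lines` import (S2's letter).  HONEST LABEL: the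
debt is MOVED to its owner BY NAME, not paid; (E-X1) OPEN; nothing closes.

ED. 4 (typ2 (g3), 2026-09-05; S2 dealer K2E1b-plan (g8) (W8) 01:24:28Z + S10 dealer R90-C138-plan (g3) 01:25:48Z (c)(iii), 01:48:35Z (B4), 02:02:09Z (2), 02:11:26Z (2);
ADDITIONS-ONLY over ED. 3): one import added — ★ `Theorems/R90S10ArchSignKitCuspOfArchBlockPacketCusp` ((H-E4-1), R90-C138-p05: from the TYPE of S2's SOURCE socket
(T2) `R90.S2.stub_R90_S2_archBlockPacketCusp` (S2 FILE D ED. 2: the block packet EXISTS together with (g) two members `k₁ k₂`, `s k₁ = 1`, `s k₂ = −1`, whose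
difference `f k₁ − f k₂` is cuspidal at every archimedean place ★ `R90.S2.CuspG₀`, stably null, and has a smooth cuspidal `Δ″_∞`-transfer `f^H_∞` ★ `R90.S2.CuspH₀`)
an ★ `ArchSignKit` whose distinguished members ARE those `k₁ k₂`, so `𝔞.frozenG = f k₁ − f k₂` by `rfl` and the pins ride on `𝔞.frozenG`, plus
`Θ_{ρ_∞}(f^H_∞) = 2` by ★ (E-R1)) — and ONE new sorry-free head (H-E4-2) `archSignKitCusp_u` = that constructor APPLIED to S2's T2 token (§2 below).  READER:
the payer of FILE F's (F-S2′) `sock_S10_realiseH₂ : RealiseH₂Letter R90.S2.CuspG₀ R90.S2.CuspH₀` (R90-C138-typ3, PAYER-TABLE-realiseH2: rows R8.3 transfer, R8.4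
stably null, R8.7–R8.10 the four cusp pins at `fG := 𝔞.frozenG`, R8.5 `Θ_{ρ_∞}(f^H_∞) = 2`, R8.6 ★ (E-R2) `𝔞.isArchSignTest_frozenG`, R8.1 ★ `𝔞.archSmooth_frozenG`).
Sorries in THIS file unchanged (exactly ONE, (E-X1)); `--axioms archSignKitCusp_u` = TRIO ∪ {`sorryAx` via S2's T2} until S2 pays T2 (payer road: S2 letters
ℓ1–ℓ4 Clozel–Delorme + Shelstad + the cusp-pin bridge ★ `R90S2ArchCuspPinBridge`; XL).  (E-X1) `stub_R90_ext_pseudoCoeffDS_u : ArchPacketSignsLetter` is NOT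
re-pointed (E1b U8 currency; consumers A, S1-C, Index).  HONEST LABEL: the (g)-debt is MOVED to S2's T2 BY NAME, not paid; nothing closes.

Sorries = exactly the two named stubs.  No `instance`, no `notation`, no `Cruxes/…/Lines` import.  Namespace `Summit.HodgeConjecture.HodgeConjecture.R90.S10`.

References: [cite: Rogawski1990, §13.8 Prop. 13.8.3 (proof) p. 218; §12.3 Prop. 12.3.2 p. 178; §12.6 p. 187; §4.3 (4.3.1) p. 43; §4.9 Prop. 4.9.1 (a) p. 55; §1.7 p. 6; §14.6 p. 242]
[cite: ClozelDelorme1984] [cite: Shelstad1983] [cite: Shelstad1979, L. 5.3] [cite: LanglandsShelstad1987, §1.3–1.4]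
-/

set_option autoImplicit false
set_option linter.dupNamespace false

noncomputable section

open NumberField MeasureTheory CompactlySupported
open scoped Matrix MatrixGroups InnerProductSpace ContDiff

namespace Summit.HodgeConjecture.HodgeConjecture.R90.S10

open Literature.NumberTheory.Automorphic
open Literature.NumberTheory.Rogawski1990
open Literature.NumberTheory.GaloisRepresentations (HeckeCharacter)
open Summit.HodgeConjecture.HodgeConjecture.Cruxes.H413.K2E1bGKCohomologyU21.U8 (ArchPacketSignsLetter)
open Summit.HodgeConjecture.HodgeConjecture.Cruxes.H413.K2E1bGKCohomologyU21.U8 (HasArchOpTrace)   -- ED. 4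
open Summit.HodgeConjecture.HodgeConjecture.R90.S2 (CuspG₀ CuspH₀)                                      -- ED. 4 (★ S2 FILE 1 `R90S2ArchCuspPinDefs`, via (H-E4-1)'s file and S2 FILE D)

/-! ## The two named stubs of FILE E (all definitions: ★ `R90S10ArchSignKitDefs`) -/

section Stubs

/-- **(E-X1) EXTERNAL — «pseudo-coefficients of the discrete series of `U(2,1)` exist» [ClozelDelorme], in the form the engine needs: the ★ E1b letter
`ArchPacketSignsLetter` BY NAME** (= the TYPE of E1b U8's tier-1 socket `sig_K2E1bArchPacketSigns`, token for token; ONE E1b payment closes both).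
EXTERNAL to Rogawski 1990: typed and audited here, NEVER dealt in S10. [cite: ClozelDelorme1984] [cite: Rogawski1990, §13.8 p. 218 lines 20–22; §12.6 p. 187] -/
theorem stub_R90_ext_pseudoCoeffDS_u : ArchPacketSignsLetter := by
  sorry

/-- **(E-S1) INTERNAL SOCKET «`f_u → f_u^H` and `Tr ρ_u(f_u^H) = 2`» (p. 218 L20–25; Prop. 12.3.2) — an `ArchSignKit` EXISTS for the block AT PRINT'S NORMALISED
DATA** (AUDIT S10#E E-F1 (a)(b), R90-C138-audit1 (g0) 2026-09-04T15:58:39Z, folded): the transfer factor is PINNED to `Δ″_∞ = archDeltaPP L μ` (no `∀ Tinf`);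
the Haar measures `ν`, `νH` that normalise every ★ `HasArchOpTrace` are the SAME measures whose Weil-form quotients the orbital-measure families are —
(W) `mG.IsQuotientOf (regular) ν t`, (C) transport of `t` under stable conjugacy inside `G_∞` (conjunct (C) of ★ `ArchCompatibleFamiliesG` at `Φ₃`, verbatim),
(W_H)+(C_H) ★ `ArchCompatibleFamiliesH L νH mH tH t` [§1.7 p. 6; §4.3 (4.3.1) p. 43; LanglandsShelstad1987 (1.4)] — which is exactly what makes Prop. 12.3.2 a true
sentence with the integer signs `⟨ρ, π⟩`; the quotient σ-algebras are `borel` (★ `ArchCompatibleFamilies` ∕ ★ `Pinned1383Letter` convention).  HYPOTHESIS-FIRST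
inputs (no second home in S10): `IsArchNondegenerate L Φ₃ Δ″_∞` (★ `isArchNondegenerate_archExplicitTransferFactor` discharges it only for ANISOTROPIC `H′`; at the
quasi-split `Φ₃` the distinguished eigenline is the anisotropic `U(Φ₁)`-line, so it holds, but no ★ sentence says so today) and the archimedean Δ-TRANSFER RELATION
★ `IsArchDeltaTransferExists` for `Δ″_∞` on the smooth classes = floor item (E5) «Shelstad real endoscopic transfer», OWNER S6 `sock_S6_ext_archTransferShelstad`
(LEAD #18 (1)); ★ `ArchEndoscopicTransferExists` is anisotropy-guarded and not usable here.  PAYER: S2 (R90-C11 ∕ K2E1b) from [ClozelDelorme] pseudo-coefficients of an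
INTEGRABLE discrete-series `L`-packet `Π(φ_∞)` of `G_∞` not of the form `ρ(θ)` with `θ` semi-regular (p. 218 (i) + «`ρ` is chosen so that `Π(ρ_v)` is integrable»:
then `f_k := d_{π_k} · c̄_{π_k}`-normalised coefficients kill EVERY other irreducible unitary representation, which is clause (ii) of `IsArchPseudoCoeffSystem`;
bare Clozel–Delorme pseudo-coefficients would not — E-F5), E-X1 ∕ E1b U8, §12.3 and the archimedean character identity Prop. 12.3.2 [Shelstad1979∕1982 for the
tempered identities].  `μ` is UNCONSTRAINED in the binder: for a `μ` off print's (`hμ` unitary, `hμres : μ|_{𝔸_{L⁺}^×} = ω_{L∕L⁺}`, bound in the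
consumers' prefix ⟪P⟫) the hypothesis (E5) for `Δ″_∞(μ)` is expected FALSE, so the socket is vacuous there BY DESIGN; consumers instantiate `μ :=` ⟪P⟫'s `μ`
(R90-C138-plan 16:11:36Z).  The kit's δ-clause and `s k₁ = 1 ≠ −1 = s k₂` exclude the junk witnesses `f := 0` and constant signs; with NO transfer pairs the `hci` clause
would be vacuous, which is why (E5) is load-bearing for A2c's `FH∞`, not for this socket's truth (E-F4).
[cite: Rogawski1990, §13.8 p. 218; §12.3 Prop. 12.3.2 p. 178; §4.9 Prop. 4.9.1 (a) p. 55; §4.3 (4.3.1) p. 43; §1.7 p. 6] [cite: ClozelDelorme1984] [cite: Shelstad1983]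
[cite: Shelstad1979, L. 5.3] [cite: LanglandsShelstad1987, §1.3–1.4] -/
theorem sock_S10_archTransferSigns_u :
    ∀ (L : Type) [Field L] [NumberField L] [IsCMField L] (μ : HeckeCharacter L)
      [MeasurableSpace (GInf L)] [BorelSpace (GInf L)] (ν : Measure (GInf L)) [ν.IsHaarMeasure] [ν.IsMulRightInvariant]
      [MeasurableSpace (HInf L)] [BorelSpace (HInf L)] (νH : Measure (HInf L)) [νH.IsHaarMeasure] [νH.IsMulRightInvariant],
    letI : ∀ a : HInf L, MeasurableSpace (HInf L ⧸ Subgroup.centralizer ({a} : Set (HInf L))) := fun _ => borel _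
    haveI : ∀ a : HInf L, BorelSpace (HInf L ⧸ Subgroup.centralizer ({a} : Set (HInf L))) := fun _ => ⟨rfl⟩
    letI : ∀ γ : GInf L, MeasurableSpace (GInf L ⧸ Subgroup.centralizer ({γ} : Set (GInf L))) := fun _ => borel _
    haveI : ∀ γ : GInf L, BorelSpace (GInf L ⧸ Subgroup.centralizer ({γ} : Set (GInf L))) := fun _ => ⟨rfl⟩
    ∀ (mH : OrbitalMeasureFamily (HInf L)) (mG : OrbitalMeasureFamily (GInf L))
      (tH : ∀ a : HInf L, Measure (Subgroup.centralizer ({a} : Set (HInf L))))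
      (t : ∀ γ : GInf L, Measure (Subgroup.centralizer ({γ} : Set (GInf L)))),
      -- (W): Weil form for `ν` at the regular classes of `G_∞`
      mG.IsQuotientOf (fun γ => IsRegularElt (γ.val : GL (Fin 3) (mixedEmbedding.mixedSpace L))) ν t →
      -- (C): transport of `t` under stable conjugacy inside `G_∞` (★ `ArchCompatibleFamiliesG`, conjunct (C), verbatim at `Φ₃`)
      (∀ (γ₁ γ₂ : GInf L)
          (h₁ : IsRegularElt (γ₁.val : GL (Fin 3) (mixedEmbedding.mixedSpace L)))
          (hc : Corresponds (UnitaryGroup.conjMixed (↥(maximalRealSubfield L)) L (IsCMField.complexConj L))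
            (UnitaryGroup.archFormOf L 3 (phi3 L)) (UnitaryGroup.archFormOf L 3 (phi3 L)) γ₁ γ₂),
          Measure.map ⇑(UnitaryGroup.archStableCentralizerEquiv L (UnitaryGroup.isUnit_antidiagOne_det L 3).ne_zero
            (UnitaryGroup.isUnit_antidiagOne_det L 3).ne_zero hc h₁) (t γ₁) = t γ₂) →
      -- (W_H) + (C_H): Weil form for `νH` and transport along `ι_∞`
      ArchCompatibleFamiliesH L νH mH tH t →
      -- non-degeneracy of `Δ″_∞` at `Φ₃` (hypothesis-first; see the docstring)
      IsArchNondegenerate L (phi3 L) (archDeltaPP L μ) →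
      -- (E5) Shelstad: archimedean Δ-transfer exists for `Δ″_∞` on the smooth classes (OWNER S6 `sock_S6_ext_archTransferShelstad`; hypothesis-first here)
      IsArchDeltaTransferExists L (phi3 L) (archDeltaPP L μ) mH mG (ArchSmooth L 3 (phi3 L)) (ArchSmooth₂ L) →
        Nonempty (ArchSignKit L (archDeltaPP L μ) mH mG ν νH) := by
  exact archTransferSigns_of_archBlockPacketIdentity Summit.HodgeConjecture.HodgeConjecture.R90.S2.stub_R90_S2_archBlockPacketSigns

end Stubs

/-! ## §2 (ED. 4) The kit WITH (g)'s cusp pins, read off S2's source socket (T2) [§13.8 Prop. 13.8.3 (proof) p. 218 L15–28; §12.3 Prop. 12.3.2 p. 178] -/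
section KitCusp

/-- (H-E4-2) **`archSignKitCusp_u` — THE ARCHIMEDEAN SIGN KIT WITH THE CUSP PINS OF RECORD** [§13.8 Prop. 13.8.3 (proof) p. 218 L15–28: «let `f_∞ = f_{π₁} − f_{π₂}` with
`⟨ρ, π₁⟩ = 1`, `⟨ρ, π₂⟩ = −1` … `f_∞` may be chosen cuspidal … its transfer `f^H_∞` cuspidal»; §12.3 Prop. 12.3.2 p. 178].  In S10's archimedean frame (the (E-S1) prefix
verbatim: (W), (C), (W_H)+(C_H) ★ `ArchCompatibleFamiliesH`, `IsArchNondegenerate`, (E5) `IsArchDeltaTransferExists` hypothesis-first) an ★ `ArchSignKit L Δ″_∞ mH mG ν νH`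
EXISTS whose frozen difference `𝔞.frozenG` is cuspidal at every archimedean place (★ `R90.S2.CuspG₀`), stably null (★ `IsArchStablyNull`), and admits a smooth
`Δ″_∞`-transfer `f^H_∞` cuspidal at every archimedean place (★ `R90.S2.CuspH₀`) with `Θ_{ρ_∞}(f^H_∞) = 2` (★ (E-R1)).  PROOF = ★ (H-E4-1) `archSignKitCusp_of_archBlockPacketCusp`
applied to S2's source socket `R90.S2.stub_R90_S2_archBlockPacketCusp` (T2, S2 FILE D ED. 2) — sorry-free here; `--axioms` = TRIO ∪ {`sorryAx` THROUGH T2} until S2 pays T2.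
READER BY NAME: R90-C138-typ3's payer of (F-S2′) `sock_S10_realiseH₂` (rows R8.1–R8.10).  HONEST LABEL: moves the (g)-debt to its owner BY NAME; pays nothing printed.
[cite: Rogawski1990, §13.8 Prop. 13.8.3 (proof) p. 218 L15–28; §12.3 Prop. 12.3.2 p. 178] [cite: ClozelDelorme1984] [cite: Shelstad1979, L. 5.3] -/
theorem archSignKitCusp_u :
    ∀ (L : Type) [Field L] [NumberField L] [IsCMField L] (μ : HeckeCharacter L)
      [MeasurableSpace (GInf L)] [BorelSpace (GInf L)] (ν : Measure (GInf L)) [ν.IsHaarMeasure] [ν.IsMulRightInvariant]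
      [MeasurableSpace (HInf L)] [BorelSpace (HInf L)] (νH : Measure (HInf L)) [νH.IsHaarMeasure] [νH.IsMulRightInvariant],
    letI : ∀ a : HInf L, MeasurableSpace (HInf L ⧸ Subgroup.centralizer ({a} : Set (HInf L))) := fun _ => borel _
    haveI : ∀ a : HInf L, BorelSpace (HInf L ⧸ Subgroup.centralizer ({a} : Set (HInf L))) := fun _ => ⟨rfl⟩
    letI : ∀ γ : GInf L, MeasurableSpace (GInf L ⧸ Subgroup.centralizer ({γ} : Set (GInf L))) := fun _ => borel _
    haveI : ∀ γ : GInf L, BorelSpace (GInf L ⧸ Subgroup.centralizer ({γ} : Set (GInf L))) := fun _ => ⟨rfl⟩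
    ∀ (mH : OrbitalMeasureFamily (HInf L)) (mG : OrbitalMeasureFamily (GInf L))
      (tH : ∀ a : HInf L, Measure (Subgroup.centralizer ({a} : Set (HInf L))))
      (t : ∀ γ : GInf L, Measure (Subgroup.centralizer ({γ} : Set (GInf L)))),
      mG.IsQuotientOf (fun γ => IsRegularElt (γ.val : GL (Fin 3) (mixedEmbedding.mixedSpace L))) ν t →
      (∀ (γ₁ γ₂ : GInf L)
          (h₁ : IsRegularElt (γ₁.val : GL (Fin 3) (mixedEmbedding.mixedSpace L)))
          (hc : Corresponds (UnitaryGroup.conjMixed (↥(maximalRealSubfield L)) L (IsCMField.complexConj L))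
            (UnitaryGroup.archFormOf L 3 (phi3 L)) (UnitaryGroup.archFormOf L 3 (phi3 L)) γ₁ γ₂),
          Measure.map ⇑(UnitaryGroup.archStableCentralizerEquiv L (UnitaryGroup.isUnit_antidiagOne_det L 3).ne_zero
            (UnitaryGroup.isUnit_antidiagOne_det L 3).ne_zero hc h₁) (t γ₁) = t γ₂) →
      ArchCompatibleFamiliesH L νH mH tH t →
      IsArchNondegenerate L (phi3 L) (archDeltaPP L μ) →
      IsArchDeltaTransferExists L (phi3 L) (archDeltaPP L μ) mH mG (ArchSmooth L 3 (phi3 L)) (ArchSmooth₂ L) →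
        ∃ 𝔞 : ArchSignKit L (archDeltaPP L μ) mH mG ν νH,
          (∀ ι : L →+* ℂ, CuspG₀ L mG ι ⇑𝔞.frozenG) ∧ IsArchStablyNull L mG ⇑𝔞.frozenG ∧
            ∃ fH : C_c(HInf L, ℂ), ArchSmooth₂ L ⇑fH ∧ IsArchDeltaTransfer L (phi3 L) (archDeltaPP L μ) mH mG ⇑fH ⇑𝔞.frozenG ∧
              (∀ ι : L →+* ℂ, CuspH₀ L mH ι ⇑fH) ∧
                (letI := 𝔞.instNACGH; letI := 𝔞.instIPSH; letI := 𝔞.instCSH; HasArchOpTrace νH 𝔞.ρH 𝔞.huH 𝔞.hscH fH 2) :=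
  archSignKitCusp_of_archBlockPacketCusp Summit.HodgeConjecture.HodgeConjecture.R90.S2.stub_R90_S2_archBlockPacketCusp

end KitCusp

end Summit.HodgeConjecture.HodgeConjecture.R90.S10

end
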